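import Mathlib.NumberTheory.ModularForms.QExpansion
import Mathlib.MeasureTheory.Measure.Haar.Unique
import Literature.NumberTheory.Automorphic.NewformAdelisationLift
import Literature.NumberTheory.Automorphic.AdeleRingTopology
import Literature.NumberTheory.Automorphic.AdicCompletionCompact
import Literature.NumberTheory.Automorphic.AdelicSecondCountable
import HarnessLib

/-!
# Adelisation of classical modular forms, III: cuspidality of the lift `φ_f`

Topic `NumberTheory/Automorphic`; layer E-III of the discharge plan of
`Literature.NumberTheory.Automorphic.Gelbart1975_exists_adelicNewform` (lang.S24). We **prove** the named fact
`adelicLift_constantTermVanishes` of `NewformAdelisationLift`: for every cusp form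
`f ∈ S_k(Γ₁(N))` the adelic lift `adelicLift N k f` on `GL₂(𝔸_ℚ) ⧸ A_G GL₂(ℚ)` has vanishing
constant term along the unipotent radical of the Borel, in the sense of the trunk
(`ConstantTermVanishes 2 ℚ · 1` of `GLnCuspidalSpectrum`: for *every* Haar measure `ν` on
`𝔫(𝔸_ℚ) ≅ 𝔸_ℚ`, *every* measurable fundamental domain `𝓕` of `𝔫(ℚ) ≅ ℚ` and every `x`, the
function `X ↦ φ_f([x (1 + X)])` is integrable on `𝓕` with integral zero). This is Gelbart (1975),
Prop. 3.1 (vii) ("`φ_f` is cuspidal because `f` vanishes at the cusps") / Bump (1997), §3.6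
(`φ ∈ A₀(GL(2, ℚ) \ GL(2, 𝔸), ω)`), for the lift defined in part II.

## The proof

Fix `ν`, `𝓕`, `x` and put `g = x⁻¹`, so that the integrand is `Θ(X) = φ_f(n(-X₀₁) g)` with
`n(t) = (1 t; 0 1)` (`unipotentOfBlock_eq_upperRightHom`).
1. *Group theory.* Write `g = γ h` with `γ ∈ GL₂(ℚ)`, `h ∈ GL₂(ℝ)⁺ × K₁(N)` (part I). With
   `C = γ⁻¹ E₀₁ γ ∈ M₂(ℚ)` and `D` a common denominator of its entries, `M = N D` satisfies
   `γ⁻¹ n(t) γ = 1 + t C ∈ K₁(N)` for `t ∈ M Ẑ` and `γ⁻¹ n(M) γ ∈ Γ₁(N)`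
   (`Rat.exists_level_conj_upperRightHom`). Hence for `t_f ∈ M Ẑ`,
   `φ_f(n(t) g) = archLift k f (γ⁻¹ n(t_∞) g_∞)` depends only on `t_∞`, and
   `H(u) = archLift k f (γ⁻¹ n(u) g_∞)` is `M`-periodic.
2. *The archimedean integral.* `archLift k f (A n(u) B) = (f ∣[k] A)(u + B i) · c(A, B)` for
   `det B > 0` (`archLift_mul_upperRightHom_mul`), and `∫₀ᴹ (f ∣[k] A)(u + z₀) du = 0` whenever
   `M` is a strict period of the level `A⁻¹ Γ₁(N) A` of the cusp form `f ∣[k] A` — Mathlib's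
   `qExpansion_coeff_eq_intervalIntegral` (`n = 0`) and `CuspFormClass.qExpansion_coeff_zero`
   (`intervalIntegral_archLift_horocycle_eq_zero`). If `det g_∞ < 0` one first moves to `GL₂(ℝ)⁺`
   with `ε = diag(-1, 1)`, which costs a complex conjugation (`archLift_mul_signGL`).
3. *The fundamental domain.* `𝔸_ℚ = ℚ ⊕ ([0, M) × M Ẑ)` uniquely
   (`Rat.existsUnique_add_algebraMap_mem_box`, from `𝔸_ℚ^∞ = ℚ + 𝒪̂` of `AdeleRingTopology` and
   `ℚ ∩ M Ẑ = M ℤ`), so the box `𝓑_M ⊆ 𝔫` is a measurable fundamental domain for `𝔫(ℚ)`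
   (`isAddFundamentalDomain_box`) of finite measure (it lies in the compact image of
   `[0, M] × M Ẑ`; `ℤ_p` is compact, `AdicCompletionCompact`). Since `Θ` is `𝔫(ℚ)`-periodic
   (`toAutomorphicQuotient_mul_glUnipotent_vadd`), continuous and bounded, integrability on `𝓕` and
   the integral over `𝓕` transfer to `𝓑_M` (Mathlib `IsAddFundamentalDomain.integrableOn_iff`,
   `setIntegral_eq`).
4. *Disintegration.* The image of `ν|_{strip}` under the real coordinate `X ↦ (X₀₁)_∞` is a
   translation-invariant measure on `ℝ` finite on compacts, hence `c · Lebesgue` by uniqueness of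
   Haar measure (`exists_realMarginal_eq_smul_volume`); so
   `∫_{𝓑_M} Θ dν = c ∫₀ᴹ H(-u) du = c ∫₀ᴹ H = 0`.

Everything is proved (`constantTermVanishes_adelicLift`, `adelicLift_constantTermVanishes_holds`).
After this file `Literature.NumberTheory.Automorphic.Gelbart1975_exists_adelicNewform` rests only on the Hecke-eigenvalue fact
`adelicLift_heckeEigenvalues` (and lang.S24 additionally on the two trunk facts and Newton–Thorne).

## References

* S. Gelbart, *Automorphic forms on adele groups*, Ann. of Math. Stud. 83 (1975), §3.A, (3.1)–(3.5),
  Prop. 3.1 (vii) [Gelbart1975].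
* D. Bump, *Automorphic forms and representations* (1997), §3.6, Thm. 3.6.1; §1.4 (Fourier
  expansions at the cusps) [Bump1997].
* J. W. S. Cassels, A. Fröhlich (eds.), *Algebraic Number Theory* (1967), Ch. II §14–15
  (`𝔸 = k + 𝔸(∞)`, compactness of `𝔸/k`) [CasselsFrohlichANT1967].
-/

noncomputable section

open Matrix NumberField IsDedekindDomain UpperHalfPlane MeasureTheory
open scoped MatrixGroups ModularForm NNReal ENNReal


namespace Literature.NumberTheory.Automorphic

open Matrix.GeneralLinearGroup IsDedekindDomain.HeightOneSpectrum
open scoped Pointwise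

/-! ### The unipotent elements `n(x) = (1 x; 0 1)` -/

section Unipotent

variable {R S : Type*} [CommRing R] [CommRing S]

/-- Entries of Mathlib's `upperRightHom x = (1 x; 0 1)`. [folklore] -/
theorem coe_upperRightHom (x : R) :
    ((upperRightHom x : GL (Fin 2) R) : Matrix (Fin 2) (Fin 2) R) = !![1, x; 0, 1] := by
  rw [upperRightHom_apply]

/-- `n(x)` is natural in the ring: `map f (1 x; 0 1) = (1 f(x); 0 1)`. [folklore] -/
theorem map_upperRightHom (f : R →+* S) (x : R) :
    Matrix.GeneralLinearGroup.map f (upperRightHom x) = upperRightHom (f x) := by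
  ext i j
  rw [Matrix.GeneralLinearGroup.map_apply, coe_upperRightHom, coe_upperRightHom]
  fin_cases i <;> fin_cases j <;> simp

/-- `det (1 x; 0 1) = 1`. [folklore] -/
theorem val_det_upperRightHom (x : R) : (upperRightHom x : GL (Fin 2) R).det.val = 1 := by
  rw [Matrix.GeneralLinearGroup.val_det_apply, coe_upperRightHom, Matrix.det_fin_two_of]
  ring

/-- `det (1 x; 0 1) = 1` as a unit. [folklore] -/
theorem det_upperRightHom (x : R) :
    Matrix.GeneralLinearGroup.det (upperRightHom x : GL (Fin 2) R) = 1 :=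
  Units.ext (val_det_upperRightHom x)

/-- `det (P⁻¹ Q P) = det Q`. [folklore] -/
theorem det_inv_mul_mul {n : Type*} [Fintype n] [DecidableEq n] (P Q : GL n R) :
    Matrix.GeneralLinearGroup.det (P⁻¹ * Q * P) = Matrix.GeneralLinearGroup.det Q := by
  rw [map_mul, map_mul, map_inv, mul_comm (Matrix.GeneralLinearGroup.det P)⁻¹, inv_mul_cancel_right]

/-- Conjugates of `n(x)`: `γ⁻¹ (1 x; 0 1) γ = 1 + x • (γ⁻¹ E₀₁ γ)` as matrices, where
`E₀₁ = (0 1; 0 0)`. [folklore] -/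
theorem coe_inv_mul_upperRightHom_mul (γ : GL (Fin 2) R) (x : R) :
    ((γ⁻¹ * upperRightHom x * γ : GL (Fin 2) R) : Matrix (Fin 2) (Fin 2) R) =
      1 + x • (((γ⁻¹ : GL (Fin 2) R) : Matrix (Fin 2) (Fin 2) R) * !![(0 : R), 1; 0, 0] *
        (γ : Matrix (Fin 2) (Fin 2) R)) := by
  have hn : ((upperRightHom x : GL (Fin 2) R) : Matrix (Fin 2) (Fin 2) R) = 1 + x • !![(0 : R), 1; 0, 0] := by
    rw [coe_upperRightHom]
    ext i j
    fin_cases i <;> fin_cases j <;> simp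
  rw [Units.val_mul, Units.val_mul, hn, Matrix.mul_add, Matrix.mul_one, Matrix.add_mul, Units.inv_mul,
    Matrix.mul_smul, Matrix.smul_mul, Matrix.mul_assoc]

/-- `n(x)` acts on the upper half plane by the real translation `z ↦ z + x` (same statement as
`Literature.NumberTheory.EllipticCurves.ModularForms.upperRightHom_smul` of `EllipticCurves/ModularSymbolsHeckeProofs`, re-proved in
three lines rather than importing that `L`-series file; librarian may merge). [folklore] -/
theorem upperRightHom_smul (x : ℝ) (z : ℍ) : (upperRightHom x : GL (Fin 2) ℝ) • z = x +ᵥ z := by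
  have hdet : 0 < (upperRightHom x : GL (Fin 2) ℝ).det.val := by rw [val_det_upperRightHom]; exact one_pos
  apply UpperHalfPlane.ext
  rw [UpperHalfPlane.coe_smul_of_det_pos hdet, UpperHalfPlane.coe_vadd]
  simp [UpperHalfPlane.num, UpperHalfPlane.denom, add_comm]

/-- `j(n(x) g, z) = j(g, z)`: the bottom row of `n(x) g` is that of `g`. [folklore] -/
theorem denom_upperRightHom_mul (x : ℝ) (g : GL (Fin 2) ℝ) (z : ℍ) :
    UpperHalfPlane.denom ((upperRightHom x : GL (Fin 2) ℝ) * g) z = UpperHalfPlane.denom g z := by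
  simp [UpperHalfPlane.denom, Units.val_mul, Matrix.mul_apply, Fin.sum_univ_two]

/-- `det (n(x) g) = det g`. [folklore] -/
theorem val_det_upperRightHom_mul (x : ℝ) (g : GL (Fin 2) ℝ) :
    ((upperRightHom x : GL (Fin 2) ℝ) * g).det.val = g.det.val := by
  rw [map_mul, Units.val_mul, val_det_upperRightHom, one_mul]

end Unipotent

/-! ### The archimedean lift along a horocycle: `t ↦ archLift k f (A n(t) B)` -/

section Horocycle

/-- **The archimedean lift along a horocycle.** For `det B > 0` and any `A`,
`archLift k f (A (n(t) B)) = (f ∣[k] A)(t + B i) · c(A, B)` with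
`c = (det B)^{k-1} j(B, i)^{-k} (√|det A · det B|)^{2-k}` independent of `t`: along `t ↦ n(t)` the
lift is the translate `f ∣[k] A` evaluated on the horizontal line through `B i`
(Gelbart (1975), proof of Prop. 3.1 (vii); Bump (1997), §3.6). [folklore] -/
theorem archLift_mul_upperRightHom_mul (k : ℤ) (f : ℍ → ℂ) (A : GL (Fin 2) ℝ) {B : GL (Fin 2) ℝ}
    (hB : 0 < B.det.val) (t : ℝ) :
    archLift k f (A * ((upperRightHom t : GL (Fin 2) ℝ) * B)) =
      (f ∣[k] A) (t +ᵥ (B • UpperHalfPlane.I)) *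
        (((B.det.val : ℝ) : ℂ) ^ (k - 1) * UpperHalfPlane.denom B UpperHalfPlane.I ^ (-k) *
          ((Real.sqrt |(A * B).det.val| : ℝ) : ℂ) ^ (2 - k)) := by
  have hdet : 0 < ((upperRightHom t : GL (Fin 2) ℝ) * B).det.val := by
    rw [val_det_upperRightHom_mul]; exact hB
  rw [archLift_apply, SlashAction.slash_mul, slash_apply_of_det_pos k _ hdet, mul_smul, upperRightHom_smul,
    denom_upperRightHom_mul, val_det_upperRightHom_mul, map_mul, map_mul, Units.val_mul, Units.val_mul,
    val_det_upperRightHom, one_mul, ← Units.val_mul, ← map_mul]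
  ring

open UpperHalfPlane in
/-- **The zeroth Fourier coefficient of a cusp form along a horizontal line vanishes**:
for a cusp form `F` of level `Γ` and a positive strict period `h ∈ Γ.strictPeriods`,
`∫₀ʰ F(u + x₀ + i y₀) du = 0` for all `x₀ ∈ ℝ`, `y₀ > 0` (Mathlib:
`qExpansion_coeff_eq_intervalIntegral` with `n = 0` and `CuspFormClass.qExpansion_coeff_zero`,
plus periodicity to shift by `x₀`). [folklore] -/
theorem intervalIntegral_vadd_eq_zero_of_cuspForm {Γ : Subgroup (GL (Fin 2) ℝ)} {k : ℤ} {F : Type*}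
    [FunLike F ℍ ℂ] [CuspFormClass F Γ k] (φ : F) {h : ℝ} (hh : 0 < h) (hΓ : h ∈ Γ.strictPeriods)
    (z₀ : ℍ) : ∫ u in (0 : ℝ)..h, φ (u +ᵥ z₀) = 0 := by
  have hper : Function.Periodic (⇑φ ∘ ofComplex) h := SlashInvariantFormClass.periodic_comp_ofComplex φ hΓ
  have : Fact (IsCusp OnePoint.infty Γ) := ⟨Γ.isCusp_of_mem_strictPeriods hh hΓ⟩
  have h0 := CuspFormClass.qExpansion_coeff_zero φ hh hΓ
  rw [qExpansion_coeff_eq_intervalIntegral hh hper (ModularFormClass.holo φ) (ModularFormClass.bdd_at_infty φ) 0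
    z₀.im_pos] at h0
  simp only [pow_zero, div_one, one_mul, one_div, mul_eq_zero, inv_eq_zero, Complex.ofReal_eq_zero, hh.ne',
    false_or] at h0
  -- `h0 : ∫ u in 0..h, φ ⟨u + y₀ I⟩ = 0`; shift by `x₀` using periodicity
  set G : ℝ → ℂ := fun u => φ (u +ᵥ (⟨(z₀.im : ℂ) * Complex.I, by simpa using z₀.im_pos⟩ : ℍ)) with hG
  have hGper : Function.Periodic G h := by
    intro u
    simp only [hG]
    have e1 : ((u + h) +ᵥ (⟨(z₀.im : ℂ) * Complex.I, by simpa using z₀.im_pos⟩ : ℍ)) =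
        ofComplex (((u : ℂ) + (z₀.im : ℂ) * Complex.I) + h) := by
      rw [ofComplex_apply_of_im_pos]
      · apply UpperHalfPlane.ext
        simp [UpperHalfPlane.coe_vadd]
        ring
      · simpa using z₀.im_pos
    have e2 : (u +ᵥ (⟨(z₀.im : ℂ) * Complex.I, by simpa using z₀.im_pos⟩ : ℍ)) =
        ofComplex ((u : ℂ) + (z₀.im : ℂ) * Complex.I) := by
      rw [ofComplex_apply_of_im_pos]
      · apply UpperHalfPlane.ext
        simp [UpperHalfPlane.coe_vadd]
      · simpa using z₀.im_pos
    rw [e1, e2]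
    exact hper _
  have hG0 : ∫ u in (0 : ℝ)..h, G u = 0 := by
    rw [← h0]
    refine intervalIntegral.integral_congr fun u _ => ?_
    simp only [hG]
    congr 1
  -- `φ (u +ᵥ z₀) = G (u + x₀)`
  have hshift : ∀ u : ℝ, φ (u +ᵥ z₀) = G (u + z₀.re) := fun u => by
    simp only [hG]
    congr 1
    apply UpperHalfPlane.ext
    apply Complex.ext <;> simp [UpperHalfPlane.coe_vadd]
  simp_rw [hshift]
  rw [intervalIntegral.integral_comp_add_right G z₀.re, zero_add]
  have := hGper.intervalIntegral_add_eq z₀.re 0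
  rw [zero_add] at this
  rw [add_comm h z₀.re, this, hG0]

/-- **Vanishing of the horocycle integral of the archimedean lift** (the archimedean heart of
Gelbart (1975), Prop. 3.1 (vii)): if `f` is a cusp form of level `Γ₁(N)`, `A, B ∈ GL₂(ℝ)` with
`det B > 0`, and `M > 0` is such that `A n(M) A⁻¹ ∈ Γ₁(N)` (i.e. `M` is a strict period of the
level `A⁻¹ Γ₁(N) A` of `f ∣[k] A`), then `∫₀ᴹ archLift k f (A n(t) B) dt = 0` and the integrand is
`M`-periodic in `t`. [cite: Gelbart1975, Prop. 3.1] -/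
theorem intervalIntegral_archLift_horocycle_eq_zero {N : ℕ} {k : ℤ} {F : Type*} [FunLike F ℍ ℂ]
    [CuspFormClass F (CongruenceSubgroup.Gamma1 N) k] (f : F) (A : GL (Fin 2) ℝ) {B : GL (Fin 2) ℝ}
    (hB : 0 < B.det.val) {M : ℝ} (hM : 0 < M)
    (hAM : A * upperRightHom M * A⁻¹ ∈
      ((CongruenceSubgroup.Gamma1 N : Subgroup SL(2, ℤ)) : Subgroup (GL (Fin 2) ℝ))) :
    ∫ t in (0 : ℝ)..M, archLift k f (A * ((upperRightHom t : GL (Fin 2) ℝ) * B)) = 0 := by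
  simp_rw [archLift_mul_upperRightHom_mul k f A hB]
  rw [intervalIntegral.integral_mul_const]
  refine mul_eq_zero_of_left ?_ _
  -- `f ∣[k] A` is a cusp form of level `A⁻¹ Γ₁(N) A`, of which `M` is a strict period
  have hper : M ∈ (ConjAct.toConjAct A⁻¹ •
      ((CongruenceSubgroup.Gamma1 N : Subgroup SL(2, ℤ)) : Subgroup (GL (Fin 2) ℝ))).strictPeriods := by
    rw [Subgroup.mem_strictPeriods_iff, ConjAct.toConjAct_inv, Subgroup.mem_inv_pointwise_smul_iff,
      ConjAct.toConjAct_smul]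
    exact hAM
  exact intervalIntegral_vadd_eq_zero_of_cuspForm (CuspForm.translate f A) hM hper (B • UpperHalfPlane.I)

/-- Periodicity of the horocycle lift: `archLift k f (A n(t + M) B) = archLift k f (A n(t) B)` when
`A n(M) A⁻¹ ∈ Γ₁(N)` (left `Γ₁(N)`-invariance of `archLift`). [cite: Gelbart1975, Prop. 3.1] -/
theorem archLift_horocycle_periodic {N : ℕ} (k : ℤ) {F : Type*} [FunLike F ℍ ℂ]
    [SlashInvariantFormClass F (CongruenceSubgroup.Gamma1 N) k] (f : F) (A B : GL (Fin 2) ℝ) {M : ℝ}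
    (hAM : A * upperRightHom M * A⁻¹ ∈
      ((CongruenceSubgroup.Gamma1 N : Subgroup SL(2, ℤ)) : Subgroup (GL (Fin 2) ℝ))) :
    Function.Periodic (fun t : ℝ => archLift k f (A * ((upperRightHom t : GL (Fin 2) ℝ) * B))) M := by
  intro t
  simp only
  have : A * ((upperRightHom (t + M) : GL (Fin 2) ℝ) * B) =
      (A * upperRightHom M * A⁻¹) * (A * ((upperRightHom t : GL (Fin 2) ℝ) * B)) := by
    rw [add_comm, AddChar.map_add_eq_mul]; group
  rw [this, archLift_mul_of_mem k f hAM]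

end Horocycle


/-! ### Complex conjugation and the sign matrix -/

section Sign

/-- The real sign matrix `ε = diag(-1, 1) ∈ GL₂(ℝ)` fixes `i`: `ε • i = i` (Mathlib's action of
an element of negative determinant is `z ↦ conj((az+b)/(cz+d))`, here `conj(-i) = i`). [folklore] -/
theorem signGL_real_smul_I :
    Matrix.GeneralLinearGroup.map (Rat.castHom ℝ) Rat.signGL • UpperHalfPlane.I = UpperHalfPlane.I := by
  apply UpperHalfPlane.ext
  rw [UpperHalfPlane.coe_smul]
  have hdet : ¬ (0 : ℝ) < (Matrix.GeneralLinearGroup.map (Rat.castHom ℝ) Rat.signGL).det.val := by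
    rw [← Rat.archGL_ofGlobal, Rat.det_archGL_signGL]; norm_num
  rw [UpperHalfPlane.σ, if_neg hdet]
  simp [UpperHalfPlane.num, UpperHalfPlane.denom, Rat.signGL, map_glDiagonal, coe_glDiagonal]

/-- **Right translation by `ε = diag(-1,1)` conjugates the archimedean lift**:
`archLift k f (X ε) = conj (archLift k f X)` (`(F ∣[k] ε)(i) = conj (F (ε i)) = conj (F i)`,
`|det ε| = 1`, `j(ε, i) = 1`). This reduces horocycle integrals through `GL₂(ℝ)⁻` to `GL₂(ℝ)⁺`. [folklore] -/
theorem archLift_mul_signGL (k : ℤ) (f : ℍ → ℂ) (X : GL (Fin 2) ℝ) :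
    archLift k f (X * Matrix.GeneralLinearGroup.map (Rat.castHom ℝ) Rat.signGL) =
      (starRingEnd ℂ) (archLift k f X) := by
  set ε : GL (Fin 2) ℝ := Matrix.GeneralLinearGroup.map (Rat.castHom ℝ) Rat.signGL with hε
  have hdetε : ε.det.val = -1 := by rw [hε, ← Rat.archGL_ofGlobal, Rat.det_archGL_signGL]
  have hdet : ¬ (0 : ℝ) < ε.det.val := by rw [hdetε]; norm_num
  have hdenom : UpperHalfPlane.denom ε UpperHalfPlane.I = 1 := by
    simp [UpperHalfPlane.denom, hε, Rat.signGL, map_glDiagonal, coe_glDiagonal]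
  have hdetX : |(X * ε).det.val| = |X.det.val| := by
    rw [map_mul, Units.val_mul, hdetε, mul_neg_one, abs_neg]
  rw [archLift_apply, archLift_apply, SlashAction.slash_mul, ModularForm.slash_apply, UpperHalfPlane.σ,
    if_neg hdet, signGL_real_smul_I, hdenom, _root_.one_zpow, mul_one, hdetε, abs_neg, abs_one,
    Complex.ofReal_one, _root_.one_zpow, mul_one, hdetX, map_mul, Complex.conjCAE_apply,
    ← Complex.ofReal_zpow, Complex.conj_ofReal]

end Sign

/-! ### Clearing denominators; the level of a conjugate horocycle -/

section Conjugation

/-- A finite set of rationals has a common denominator. [folklore] -/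
theorem Rat.exists_pos_forall_mul_eq_intCast (s : Finset ℚ) :
    ∃ D : ℕ, 0 < D ∧ ∀ q ∈ s, ∃ z : ℤ, (D : ℚ) * q = z := by
  classical
  refine ⟨∏ q ∈ s, q.den, Finset.prod_pos fun q _ => q.den_pos, fun q hq => ?_⟩
  refine ⟨(∏ q' ∈ s.erase q, (q'.den : ℤ)) * q.num, ?_⟩
  rw [← Finset.prod_erase_mul _ _ hq]
  push_cast
  rw [mul_assoc, mul_comm (q.den : ℚ) q, Rat.mul_den_eq_num]

/-- Entries of a conjugate unipotent over an algebra: for `γ ∈ GL₂(R)`, a ring map `φ : R → S` and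
`t ∈ S`, `(φ(γ)⁻¹ n(t) φ(γ))_{ij} = δ_{ij} + t φ(C_{ij})` with `C = γ⁻¹ E₀₁ γ`. [folklore] -/
theorem coe_map_inv_mul_upperRightHom_mul_map {R S : Type*} [CommRing R] [CommRing S] (φ : R →+* S)
    (γ : GL (Fin 2) R) (t : S) (i j : Fin 2) :
    (((Matrix.GeneralLinearGroup.map φ γ)⁻¹ * upperRightHom t * Matrix.GeneralLinearGroup.map φ γ :
        GL (Fin 2) S) : Matrix (Fin 2) (Fin 2) S) i j =
      (1 : Matrix (Fin 2) (Fin 2) S) i j +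
        t * φ ((((γ⁻¹ : GL (Fin 2) R) : Matrix (Fin 2) (Fin 2) R) * !![(0 : R), 1; 0, 0] *
          (γ : Matrix (Fin 2) (Fin 2) R)) i j) := by
  rw [coe_inv_mul_upperRightHom_mul, Matrix.add_apply, Matrix.smul_apply, smul_eq_mul]
  congr 2
  have h1 : (((Matrix.GeneralLinearGroup.map φ γ)⁻¹ : GL (Fin 2) S) : Matrix (Fin 2) (Fin 2) S) =
      (((γ⁻¹ : GL (Fin 2) R) : Matrix (Fin 2) (Fin 2) R)).map φ := by
    rw [← map_inv]; rfl
  have h2 : ((Matrix.GeneralLinearGroup.map φ γ : GL (Fin 2) S) : Matrix (Fin 2) (Fin 2) S) =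
      (γ : Matrix (Fin 2) (Fin 2) R).map φ := rfl
  have h3 : (!![(0 : S), 1; 0, 0] : Matrix (Fin 2) (Fin 2) S) = (!![(0 : R), 1; 0, 0]).map φ := by
    ext a b; fin_cases a <;> fin_cases b <;> simp
  rw [h1, h2, h3, ← Matrix.map_mul, ← Matrix.map_mul, Matrix.map_apply]

/-- If `t ∈ (N D) Ẑ` and `D c ∈ ℤ` then `t c ∈ N Ẑ` (`|t c|_v ≤ |N D|_v |c|_v = |N|_v |D c|_v ≤ |N|_v`). [folklore] -/
theorem mul_algebraMap_mem_levelIdeal_of_mem {N D : ℕ} (hN : N ≠ 0) (hD : D ≠ 0)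
    {t : FiniteAdeleRing (𝓞 ℚ) ℚ} (ht : t ∈ levelIdeal ℚ (Ideal.span {((N * D : ℕ) : 𝓞 ℚ)}))
    {c : ℚ} {z : ℤ} (hz : (D : ℚ) * c = z) :
    t * algebraMap ℚ (FiniteAdeleRing (𝓞 ℚ) ℚ) c ∈ levelIdeal ℚ (Ideal.span {(N : 𝓞 ℚ)}) := by
  rw [mem_levelIdeal_iff] at ht ⊢
  intro v
  have hv := ht v
  rw [Rat.idealRadius_span_natCast v (mul_ne_zero hN hD)] at hv
  rw [Rat.idealRadius_span_natCast v hN, FiniteAdeleRing.mul_apply', Valuation.map_mul,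
    FiniteAdeleRing.algebraMap_apply, valuedAdicCompletion_eq_valuation']
  have hc : c = (z : ℚ) / D := by
    rw [eq_div_iff (by exact_mod_cast hD : (D : ℚ) ≠ 0), mul_comm, hz]
  have hzv : v.valuation ℚ (z : ℚ) ≤ 1 := by
    rw [← map_intCast (algebraMap (𝓞 ℚ) ℚ), valuation_of_algebraMap]
    exact intValuation_le_one v _
  have hDv : v.valuation ℚ (D : ℚ) ≠ 0 := (Valuation.ne_zero_iff _).2 (by exact_mod_cast hD)
  calc Valued.v (t v) * v.valuation ℚ c
      ≤ v.valuation ℚ ((N * D : ℕ) : ℚ) * v.valuation ℚ c := mul_le_mul_left hv _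
    _ = v.valuation ℚ (N : ℚ) * v.valuation ℚ (z : ℚ) := by
        rw [hc, map_div₀, Nat.cast_mul, Valuation.map_mul, mul_assoc, mul_div_cancel₀ _ hDv]
    _ ≤ v.valuation ℚ (N : ℚ) * 1 := mul_le_mul_right hzv _
    _ = v.valuation ℚ (N : ℚ) := mul_one _

/-- **The level of a conjugate horocycle** (the elementary input to Gelbart (1975),
Prop. 3.1 (vii)): for `γ ∈ GL₂(ℚ)` and `N ≥ 1` there is `M ≥ 1` such that
(i) `γ⁻¹ n(t) γ ∈ K₁(N)` in `GL₂(𝔸_ℚ^∞)` for every `t ∈ M Ẑ`, and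
(ii) `γ⁻¹ n(M) γ ∈ Γ₁(N)` in `GL₂(ℝ)`, i.e. `M` is a strict period of the level `γ Γ₁(N) γ⁻¹` of
`f ∣[k] γ⁻¹`. Take `M = N D` with `D` a common denominator of the entries of `C = γ⁻¹ E₀₁ γ`
(`γ⁻¹ n(t) γ = 1 + t C`); (ii) follows from (i) at `t = M` through
`GL₂(ℚ) ∩ (GL₂(ℝ)⁺ × K₁(N)) = Γ₁(N)` (`Rat.archGL_ofGlobal_mem_gamma1`). [folklore] -/
theorem Rat.exists_level_conj_upperRightHom (N : ℕ) [NeZero N] (γ : GL (Fin 2) ℚ) :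
    ∃ M : ℕ, 0 < M ∧
      (∀ t : FiniteAdeleRing (𝓞 ℚ) ℚ, t ∈ levelIdeal ℚ (Ideal.span {(M : 𝓞 ℚ)}) →
        (Matrix.GeneralLinearGroup.map (algebraMap ℚ (FiniteAdeleRing (𝓞 ℚ) ℚ)) γ)⁻¹ * upperRightHom t *
            Matrix.GeneralLinearGroup.map (algebraMap ℚ (FiniteAdeleRing (𝓞 ℚ) ℚ)) γ ∈
          gammaOneFiniteLevel ℚ (Ideal.span {(N : 𝓞 ℚ)})) ∧
      (Matrix.GeneralLinearGroup.map (Rat.castHom ℝ) γ)⁻¹ * upperRightHom (M : ℝ) *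
          Matrix.GeneralLinearGroup.map (Rat.castHom ℝ) γ ∈
        ((CongruenceSubgroup.Gamma1 N : Subgroup SL(2, ℤ)) : Subgroup (GL (Fin 2) ℝ)) := by
  classical
  have hN : N ≠ 0 := NeZero.ne N
  set C : Matrix (Fin 2) (Fin 2) ℚ :=
    ((γ⁻¹ : GL (Fin 2) ℚ) : Matrix (Fin 2) (Fin 2) ℚ) * !![(0 : ℚ), 1; 0, 0] * (γ : Matrix (Fin 2) (Fin 2) ℚ)
    with hC
  obtain ⟨D, hD, hDC⟩ := Rat.exists_pos_forall_mul_eq_intCast (Finset.univ.image fun p : Fin 2 × Fin 2 => C p.1 p.2)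
  have hDC' : ∀ i j, ∃ z : ℤ, (D : ℚ) * C i j = z := fun i j =>
    hDC _ (Finset.mem_image.2 ⟨(i, j), Finset.mem_univ _, rfl⟩)
  set φ := algebraMap ℚ (FiniteAdeleRing (𝓞 ℚ) ℚ) with hφ
  -- (i)
  have key : ∀ t : FiniteAdeleRing (𝓞 ℚ) ℚ, t ∈ levelIdeal ℚ (Ideal.span {((N * D : ℕ) : 𝓞 ℚ)}) →
      (Matrix.GeneralLinearGroup.map φ γ)⁻¹ * upperRightHom t * Matrix.GeneralLinearGroup.map φ γ ∈
        gammaOneFiniteLevel ℚ (Ideal.span {(N : 𝓞 ℚ)}) := by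
    intro t ht
    -- entries of `γ⁻¹ n(s) γ` for `s ∈ (N D) Ẑ`
    have hent : ∀ {s : FiniteAdeleRing (𝓞 ℚ) ℚ}, s ∈ levelIdeal ℚ (Ideal.span {((N * D : ℕ) : 𝓞 ℚ)}) →
        ∀ i j, ((((Matrix.GeneralLinearGroup.map φ γ)⁻¹ * upperRightHom s * Matrix.GeneralLinearGroup.map φ γ :
          GL (Fin 2) (FiniteAdeleRing (𝓞 ℚ) ℚ)) : Matrix (Fin 2) (Fin 2) (FiniteAdeleRing (𝓞 ℚ) ℚ)) i j -
            (1 : Matrix (Fin 2) (Fin 2) (FiniteAdeleRing (𝓞 ℚ) ℚ)) i j ∈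
          levelIdeal ℚ (Ideal.span {(N : 𝓞 ℚ)})) := by
      intro s hs i j
      obtain ⟨z, hz⟩ := hDC' i j
      rw [coe_map_inv_mul_upperRightHom_mul_map, add_sub_cancel_left]
      exact mul_algebraMap_mem_levelIdeal_of_mem hN hD.ne' hs hz
    have hint : ∀ {s : FiniteAdeleRing (𝓞 ℚ) ℚ}, s ∈ levelIdeal ℚ (Ideal.span {((N * D : ℕ) : 𝓞 ℚ)}) →
        ∀ i j, ((((Matrix.GeneralLinearGroup.map φ γ)⁻¹ * upperRightHom s * Matrix.GeneralLinearGroup.map φ γ :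
          GL (Fin 2) (FiniteAdeleRing (𝓞 ℚ) ℚ)) : Matrix (Fin 2) (Fin 2) (FiniteAdeleRing (𝓞 ℚ) ℚ)) i j ∈
          integralFiniteAdeles ℚ) := by
      intro s hs i j
      have h := mem_integralFiniteAdeles_of_mem_levelIdeal (hent hs i j)
      have h1 : (1 : Matrix (Fin 2) (Fin 2) (FiniteAdeleRing (𝓞 ℚ) ℚ)) i j ∈ integralFiniteAdeles ℚ := by
        rw [Matrix.one_apply]; split_ifs <;> simp [one_mem, zero_mem]
      simpa using add_mem h h1
    have hinv : ((Matrix.GeneralLinearGroup.map φ γ)⁻¹ * upperRightHom t * Matrix.GeneralLinearGroup.map φ γ)⁻¹ =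
        (Matrix.GeneralLinearGroup.map φ γ)⁻¹ * upperRightHom (-t) * Matrix.GeneralLinearGroup.map φ γ := by
      rw [AddChar.map_neg_eq_inv]; group
    have ht' : -t ∈ levelIdeal ℚ (Ideal.span {((N * D : ℕ) : 𝓞 ℚ)}) := neg_mem ht
    rw [mem_gammaOneFiniteLevel_iff, mem_gammaZeroFiniteLevel_iff, mem_eichlerOrder_iff, mem_eichlerOrder_iff, hinv]
    refine ⟨⟨⟨hint ht, ?_⟩, hint ht', ?_⟩, ?_⟩
    · simpa [Matrix.one_apply_ne (show (1 : Fin 2) ≠ 0 by decide)] using hent ht 1 0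
    · simpa [Matrix.one_apply_ne (show (1 : Fin 2) ≠ 0 by decide)] using hent ht' 1 0
    · simpa [Matrix.one_apply_eq] using hent ht 1 1
  refine ⟨N * D, Nat.mul_pos (NeZero.pos N) hD, key, ?_⟩
  -- (ii) from (i) at `t = M`
  set δ : GL (Fin 2) ℚ := γ⁻¹ * upperRightHom ((N * D : ℕ) : ℚ) * γ with hδ
  have hδmem : GLn.ofGlobal 2 ℚ δ ∈ Rat.plusLevelOne (Ideal.span {(N : 𝓞 ℚ)}) := by
    rw [Rat.mem_plusLevelOne_iff, Rat.archGL_ofGlobal, Rat.sndHom_ofGlobal]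
    have hdetδ : Matrix.GeneralLinearGroup.det δ = 1 := by
      rw [hδ, map_mul, map_mul, map_inv, det_upperRightHom, mul_one, inv_mul_cancel]
    constructor
    · rw [Matrix.GeneralLinearGroup.map_det, hdetδ, map_one, Units.val_one]
      exact one_pos
    · rw [map_mul, map_mul, map_inv, map_upperRightHom]
      refine key _ ?_
      rw [Rat.algebraMap_mem_levelIdeal_iff (mul_ne_zero hN hD.ne')]
      intro v
      exact le_rfl
  have hmem := Rat.archGL_ofGlobal_mem_gamma1 hδmem
  rw [Rat.archGL_ofGlobal, hδ, map_mul, map_mul, map_inv, map_upperRightHom, map_natCast] at hmem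
  exact_mod_cast hmem

end Conjugation


/-! ### The unipotent radical `𝔫 ≅ 𝔸_ℚ` of the Borel of `GL₂`: coordinates -/

section Block

/-- The coordinate `X ↦ X₀₁` on the block-nilpotent matrices `𝔫 = 𝔫_1 ≤ M₂(𝔸_ℚ)` of the trunk
(`blockNilpotent 2 1`: matrices supported in the entry `(0, 1)`), an additive isomorphism
`𝔫 ≅ 𝔸_ℚ` (inverse `blockOfEntry`). [folklore] -/
def blockEntry : blockNilpotent 2 1 (AdeleRing (𝓞 ℚ) ℚ) →+ AdeleRing (𝓞 ℚ) ℚ where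
  toFun X := (X : Matrix (Fin 2) (Fin 2) (AdeleRing (𝓞 ℚ) ℚ)) 0 1
  map_zero' := rfl
  map_add' _ _ := rfl

/-- `blockEntry X = X₀₁` (definitional). [folklore] -/
theorem blockEntry_apply (X : blockNilpotent 2 1 (AdeleRing (𝓞 ℚ) ℚ)) :
    blockEntry X = (X : Matrix (Fin 2) (Fin 2) (AdeleRing (𝓞 ℚ) ℚ)) 0 1 :=
  rfl

/-- The entries of `X ∈ 𝔫` other than `X₀₁` vanish. [folklore] -/
theorem coe_apply_eq_zero_of_ne (X : blockNilpotent 2 1 (AdeleRing (𝓞 ℚ) ℚ)) {i j : Fin 2}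
    (h : ¬ (i = 0 ∧ j = 1)) : (X : Matrix (Fin 2) (Fin 2) (AdeleRing (𝓞 ℚ) ℚ)) i j = 0 := by
  refine apply_eq_zero_of_mem_blockNilpotent X.2 fun h' => h ?_
  obtain ⟨h1, h2⟩ := h'
  constructor
  · exact Fin.ext (by omega)
  · exact Fin.ext (by omega)

/-- `blockEntry` is continuous. [folklore] -/
theorem continuous_blockEntry : Continuous blockEntry :=
  Continuous.matrix_elem
    (A := fun X : blockNilpotent 2 1 (AdeleRing (𝓞 ℚ) ℚ) => (X : Matrix (Fin 2) (Fin 2) (AdeleRing (𝓞 ℚ) ℚ)))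
    continuous_subtype_val 0 1

/-- The inverse coordinate `t ↦ t E₀₁ ∈ 𝔫`. [folklore] -/
def blockOfEntry : AdeleRing (𝓞 ℚ) ℚ →+ blockNilpotent 2 1 (AdeleRing (𝓞 ℚ) ℚ) where
  toFun t := ⟨!![0, t; 0, 0], fun i j hij => by
    fin_cases i <;> fin_cases j <;> simp at hij ⊢⟩
  map_zero' := by
    apply Subtype.ext
    ext i j; fin_cases i <;> fin_cases j <;> rfl
  map_add' s t := by
    apply Subtype.ext
    change !![(0 : AdeleRing (𝓞 ℚ) ℚ), s + t; 0, 0] = !![0, s; 0, 0] + !![0, t; 0, 0]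
    ext i j; fin_cases i <;> fin_cases j <;> simp

/-- `(blockOfEntry t)₀₁ = t`. [folklore] -/
@[simp]
theorem blockEntry_blockOfEntry (t : AdeleRing (𝓞 ℚ) ℚ) : blockEntry (blockOfEntry t) = t :=
  rfl

/-- `blockOfEntry (X₀₁) = X`: `𝔫` is one-dimensional. [folklore] -/
@[simp]
theorem blockOfEntry_blockEntry (X : blockNilpotent 2 1 (AdeleRing (𝓞 ℚ) ℚ)) : blockOfEntry (blockEntry X) = X := by
  apply Subtype.ext
  ext i j
  change (!![0, (X : Matrix (Fin 2) (Fin 2) (AdeleRing (𝓞 ℚ) ℚ)) 0 1; 0, 0] : Matrix _ _ _) i j = _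
  fin_cases i <;> fin_cases j
  · exact (coe_apply_eq_zero_of_ne X (by simp)).symm
  · rfl
  · exact (coe_apply_eq_zero_of_ne X (by simp)).symm
  · exact (coe_apply_eq_zero_of_ne X (by simp)).symm

/-- `blockEntry` is injective. [folklore] -/
theorem blockEntry_injective : Function.Injective blockEntry := fun X Y h => by
  rw [← blockOfEntry_blockEntry X, ← blockOfEntry_blockEntry Y, h]

/-- `blockOfEntry` is continuous. [folklore] -/
theorem continuous_blockOfEntry : Continuous blockOfEntry := by
  refine Continuous.subtype_mk (continuous_matrix fun i j => ?_) _
  fin_cases i <;> fin_cases j <;> simp <;> fun_prop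

/-- **The unipotent element of the trunk is `n(X₀₁)`**: `unipotentOfBlock (= glUnipotent) X = 1 + X
= (1 X₀₁; 0 1) = upperRightHom (blockEntry X)` in `GL₂(𝔸_ℚ)`. [folklore] -/
theorem unipotentOfBlock_eq_upperRightHom (X : blockNilpotent 2 1 (AdeleRing (𝓞 ℚ) ℚ)) :
    unipotentOfBlock 2 1 (AdeleRing (𝓞 ℚ) ℚ) (Multiplicative.ofAdd X) = upperRightHom (blockEntry X) := by
  refine Units.ext ?_
  rw [coe_unipotentOfBlock, coe_upperRightHom]
  ext i j
  change (1 : Matrix (Fin 2) (Fin 2) (AdeleRing (𝓞 ℚ) ℚ)) i j + (X : Matrix (Fin 2) (Fin 2) (AdeleRing (𝓞 ℚ) ℚ)) i j = _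
  fin_cases i <;> fin_cases j
  · rw [coe_apply_eq_zero_of_ne X (by simp)]; simp
  · simp [blockEntry_apply]
  · rw [coe_apply_eq_zero_of_ne X (by simp)]; simp
  · rw [coe_apply_eq_zero_of_ne X (by simp)]; simp

/-- `X ↦ 1 + X : 𝔫 → GL₂(𝔸_ℚ)` is continuous. [folklore] -/
theorem continuous_unipotentOfBlock_ofAdd :
    Continuous fun X : blockNilpotent 2 1 (AdeleRing (𝓞 ℚ) ℚ) =>
      unipotentOfBlock 2 1 (AdeleRing (𝓞 ℚ) ℚ) (Multiplicative.ofAdd X) := by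
  rw [Units.continuous_iff]
  constructor
  · change Continuous fun X : blockNilpotent 2 1 (AdeleRing (𝓞 ℚ) ℚ) =>
      (1 : Matrix (Fin 2) (Fin 2) (AdeleRing (𝓞 ℚ) ℚ)) + (X : Matrix (Fin 2) (Fin 2) (AdeleRing (𝓞 ℚ) ℚ))
    exact continuous_const.add continuous_subtype_val
  · change Continuous fun X : blockNilpotent 2 1 (AdeleRing (𝓞 ℚ) ℚ) =>
      (1 : Matrix (Fin 2) (Fin 2) (AdeleRing (𝓞 ℚ) ℚ)) - (X : Matrix (Fin 2) (Fin 2) (AdeleRing (𝓞 ℚ) ℚ))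
    exact continuous_const.sub continuous_subtype_val

/-- `X ∈ 𝔫(ℚ)` (rational block) iff its coordinate `X₀₁` is a principal adele. [folklore] -/
theorem mem_rationalBlock_iff_blockEntry {X : blockNilpotent 2 1 (AdeleRing (𝓞 ℚ) ℚ)} :
    X ∈ rationalBlock 2 1 ℚ ↔ blockEntry X ∈ (algebraMap ℚ (AdeleRing (𝓞 ℚ) ℚ)).range := by
  rw [mem_rationalBlock_iff]
  refine ⟨fun h => h 0 1, fun h i j => ?_⟩
  by_cases hij : i = 0 ∧ j = 1
  · obtain ⟨rfl, rfl⟩ := hij; exact h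
  · rw [coe_apply_eq_zero_of_ne X hij]; exact ⟨0, map_zero _⟩

/-- `blockOfEntry` of a principal adele is rational. [folklore] -/
theorem blockOfEntry_algebraMap_mem_rationalBlock (q : ℚ) :
    blockOfEntry (algebraMap ℚ (AdeleRing (𝓞 ℚ) ℚ) q) ∈ rationalBlock 2 1 ℚ :=
  mem_rationalBlock_iff_blockEntry.2 ⟨q, rfl⟩

/-- `𝔫(ℚ) ≅ ℚ` is countable. [folklore] -/
instance countable_rationalBlock : Countable (rationalBlock 2 1 ℚ) := by
  have h : ∀ X : rationalBlock 2 1 ℚ, ∃ q : ℚ, algebraMap ℚ (AdeleRing (𝓞 ℚ) ℚ) q = blockEntry (X : blockNilpotent 2 1 _) :=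
    fun X => mem_rationalBlock_iff_blockEntry.1 X.2
  choose q hq using h
  refine Function.Injective.countable (f := q) fun X Y hXY => ?_
  apply Subtype.ext
  apply blockEntry_injective
  rw [← hq X, ← hq Y, hXY]

/-- The archimedean part of `n(t)`, `t ∈ 𝔸_ℚ`, is `n(t_∞)`. [folklore] -/
theorem Rat.archGL_upperRightHom (t : AdeleRing (𝓞 ℚ) ℚ) :
    Rat.archGL 2 (upperRightHom t) = upperRightHom (Rat.infiniteAdeleRingEquivReal t.1) := by
  change Matrix.GeneralLinearGroup.map _ (Matrix.GeneralLinearGroup.map _ (upperRightHom t)) = _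
  rw [map_upperRightHom, map_upperRightHom]
  rfl

/-- The finite part of `n(t)` is `n(t_f)`. [folklore] -/
theorem Rat.sndHom_upperRightHom (t : AdeleRing (𝓞 ℚ) ℚ) :
    GLn.sndHom 2 ℚ (upperRightHom t) = upperRightHom t.2 := by
  change Matrix.GeneralLinearGroup.map _ (upperRightHom t) = _
  rw [map_upperRightHom]
  rfl

/-- `n(q)`, `q ∈ ℚ`, is a global element. [folklore] -/
theorem upperRightHom_algebraMap (q : ℚ) :
    upperRightHom (algebraMap ℚ (AdeleRing (𝓞 ℚ) ℚ) q) = GLn.ofGlobal 2 ℚ (upperRightHom q) := by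
  rw [GLn.ofGlobal, map_upperRightHom]

end Block

/-! ### `𝔸_ℚ = ℚ ⊕ ([0, M) × M Ẑ)`: a fundamental domain for `ℚ` in `𝔸_ℚ` -/

section FundamentalDomain

/-- `M · 𝒪̂ ⊆ M Ẑ`: `M x ∈ levelIdeal (M)` for `x` integral. [folklore] -/
theorem algebraMap_natCast_mul_mem_levelIdeal {M : ℕ} (hM : M ≠ 0) {x : FiniteAdeleRing (𝓞 ℚ) ℚ}
    (hx : ∀ v, x v ∈ v.adicCompletionIntegers ℚ) :
    algebraMap ℚ (FiniteAdeleRing (𝓞 ℚ) ℚ) M * x ∈ levelIdeal ℚ (Ideal.span {(M : 𝓞 ℚ)}) := by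
  rw [mem_levelIdeal_iff]
  intro v
  rw [Rat.idealRadius_span_natCast v hM, FiniteAdeleRing.mul_apply', Valuation.map_mul,
    FiniteAdeleRing.algebraMap_apply, valuedAdicCompletion_eq_valuation']
  exact mul_le_of_le_one_right zero_le ((mem_adicCompletionIntegers _ _ _).1 (hx v))

/-- The principal adele of `M z`, `z ∈ ℤ`, lies in `M Ẑ`. [folklore] -/
theorem algebraMap_natCast_mul_intCast_mem_levelIdeal {M : ℕ} (hM : M ≠ 0) (z : ℤ) :
    algebraMap ℚ (FiniteAdeleRing (𝓞 ℚ) ℚ) ((M : ℚ) * z) ∈ levelIdeal ℚ (Ideal.span {(M : 𝓞 ℚ)}) := by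
  rw [map_mul]
  refine algebraMap_natCast_mul_mem_levelIdeal hM fun v => ?_
  rw [mem_adicCompletionIntegers, FiniteAdeleRing.algebraMap_apply, valuedAdicCompletion_eq_valuation',
    ← map_intCast (algebraMap (𝓞 ℚ) ℚ), valuation_of_algebraMap]
  exact intValuation_le_one v _

/-- Components of a sum of adeles (definitional for Mathlib's `AdeleRing = InfiniteAdeleRing × FiniteAdeleRing`). [folklore] -/
theorem AdeleRing.fst_add' (x y : AdeleRing (𝓞 ℚ) ℚ) : (x + y).1 = x.1 + y.1 := rfl

/-- Components of a sum of adeles, finite part (definitional). [folklore] -/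
theorem AdeleRing.snd_add' (x y : AdeleRing (𝓞 ℚ) ℚ) : (x + y).2 = x.2 + y.2 := rfl

/-- Components of the negative of an adele, archimedean part (definitional). [folklore] -/
theorem AdeleRing.fst_neg' (x : AdeleRing (𝓞 ℚ) ℚ) : (-x).1 = -x.1 := rfl

/-- Components of the negative of an adele, finite part (definitional). [folklore] -/
theorem AdeleRing.snd_neg' (x : AdeleRing (𝓞 ℚ) ℚ) : (-x).2 = -x.2 := rfl

/-- Real parts of principal adeles: `(q)_∞ = q` under `𝔸_{ℚ,∞} = ℝ`. [folklore] -/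
theorem Rat.infiniteAdeleRingEquivReal_fst_algebraMap (q : ℚ) :
    Rat.infiniteAdeleRingEquivReal (algebraMap ℚ (AdeleRing (𝓞 ℚ) ℚ) q).1 = q := by
  rw [algebraMap_adeleRing_fst, Rat.infiniteAdeleRingEquivReal_algebraMap]

/-- **`𝔸_ℚ = ℚ + ([0, M) × M Ẑ)` uniquely** (strong approximation for the adeles of `ℚ`:
`𝔸_ℚ = ℚ + (ℝ × Ẑ)`, `ℚ ∩ (ℝ × M Ẑ) = M ℤ`; Cassels–Fröhlich, Ch. II §14; Gelbart (1975), §3.A):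
for every adele `t` and `M ≥ 1` there is a unique rational `r` with `(t + r)_∞ ∈ [0, M)` and
`(t + r)_f ∈ M Ẑ`. Existence: `t_f ∈ ℚ + 𝒪̂` (`FiniteAdeleRing.exists_forall_sub_algebraMap_mem`
applied to `t_f / M`), then adjust by an element of `M ℤ` using `toIcoDiv` on the real part;
uniqueness: two solutions differ by an element of `ℚ ∩ M Ẑ = M ℤ` of absolute value `< M`. [folklore] -/
theorem Rat.existsUnique_add_algebraMap_mem_box {M : ℕ} (hM : 0 < M) (t : AdeleRing (𝓞 ℚ) ℚ) :
    ∃! r : ℚ, Rat.infiniteAdeleRingEquivReal (t + algebraMap ℚ (AdeleRing (𝓞 ℚ) ℚ) r).1 ∈ Set.Ico (0 : ℝ) M ∧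
      (t + algebraMap ℚ (AdeleRing (𝓞 ℚ) ℚ) r).2 ∈ levelIdeal ℚ (Ideal.span {(M : 𝓞 ℚ)}) := by
  have hM0 : M ≠ 0 := hM.ne'
  have hMq : (M : ℚ) ≠ 0 := by exact_mod_cast hM0
  have hMr : (0 : ℝ) < M := by exact_mod_cast hM
  set e := Rat.infiniteAdeleRingEquivReal with he
  -- finite part: `t_f / M = k₁ + integral`
  obtain ⟨k₁, hk₁⟩ := FiniteAdeleRing.exists_forall_sub_algebraMap_mem (𝓞 ℚ) ℚ
    (algebraMap ℚ (FiniteAdeleRing (𝓞 ℚ) ℚ) (M : ℚ)⁻¹ * t.2)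
  set r₁ : ℚ := -(M * k₁) with hr₁
  have hfin : ∀ z : ℤ, (t + algebraMap ℚ (AdeleRing (𝓞 ℚ) ℚ) (r₁ - M * z)).2 ∈
      levelIdeal ℚ (Ideal.span {(M : 𝓞 ℚ)}) := fun z => by
    have h1 := algebraMap_natCast_mul_mem_levelIdeal hM0 hk₁
    have h2 := algebraMap_natCast_mul_intCast_mem_levelIdeal hM0 z
    have e2 : (t + algebraMap ℚ (AdeleRing (𝓞 ℚ) ℚ) (r₁ - M * z)).2 =
        algebraMap ℚ (FiniteAdeleRing (𝓞 ℚ) ℚ) M *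
            (algebraMap ℚ (FiniteAdeleRing (𝓞 ℚ) ℚ) (M : ℚ)⁻¹ * t.2 - algebraMap ℚ (FiniteAdeleRing (𝓞 ℚ) ℚ) k₁) -
          algebraMap ℚ (FiniteAdeleRing (𝓞 ℚ) ℚ) ((M : ℚ) * z) := by
      rw [AdeleRing.snd_add', algebraMap_adeleRing_snd, hr₁, mul_sub, ← mul_assoc, ← map_mul, mul_inv_cancel₀ hMq,
        map_one, one_mul, map_sub, map_neg, ← map_mul]
      ring
    rw [e2]
    exact sub_mem h1 h2
  -- real part
  set s : ℝ := e t.1 + r₁ with hs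
  set n : ℤ := toIcoDiv hMr 0 s with hn
  have hreal : ∀ z : ℤ, e (t + algebraMap ℚ (AdeleRing (𝓞 ℚ) ℚ) (r₁ - M * z)).1 = s - z • (M : ℝ) := fun z => by
    rw [AdeleRing.fst_add', map_add, Rat.infiniteAdeleRingEquivReal_fst_algebraMap, hs]
    push_cast
    rw [zsmul_eq_mul]
    ring
  refine ⟨r₁ - M * n, ⟨?_, hfin n⟩, ?_⟩
  · rw [hreal, hn, self_sub_toIcoDiv_zsmul]
    simpa using toIcoMod_mem_Ico hMr 0 s
  · rintro r' ⟨h1', h2'⟩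
    -- `r' - r₁ ∈ ℚ ∩ M Ẑ = M ℤ`
    have hdiff : algebraMap ℚ (FiniteAdeleRing (𝓞 ℚ) ℚ) (r' - (r₁ - M * n)) ∈
        levelIdeal ℚ (Ideal.span {(M : 𝓞 ℚ)}) := by
      have := sub_mem h2' (hfin n)
      rwa [AdeleRing.snd_add', AdeleRing.snd_add', add_sub_add_left_eq_sub, algebraMap_adeleRing_snd,
        algebraMap_adeleRing_snd, ← map_sub] at this
    obtain ⟨z, hz⟩ := Rat.exists_eq_natCast_mul_of_valuation_le hM0
      ((Rat.algebraMap_mem_levelIdeal_iff hM0 _).1 hdiff)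
    -- so `r' = r₁ - M (n - z)`, and both real parts lie in `[0, M)`
    have hr' : r' = r₁ - M * ((n - z : ℤ) : ℚ) := by push_cast; linarith
    rw [hr', hreal] at h1'
    have hn' : toIcoDiv hMr 0 s = n - z := toIcoDiv_eq_of_sub_zsmul_mem_Ico hMr (by simpa using h1')
    have hz0 : z = 0 := by rw [← hn] at hn'; omega
    rw [hr', hz0, sub_zero]

/-- **The box** `𝓑_M = {X ∈ 𝔫 | (X₀₁)_∞ ∈ [0, M), (X₀₁)_f ∈ M Ẑ}`: a fundamental domain for the
rational block `𝔫(ℚ) ≅ ℚ` acting on `𝔫 ≅ 𝔸_ℚ` by translation (`isAddFundamentalDomain_box`). [folklore] -/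
def box (M : ℕ) : Set (blockNilpotent 2 1 (AdeleRing (𝓞 ℚ) ℚ)) :=
  {X | Rat.infiniteAdeleRingEquivReal (blockEntry X).1 ∈ Set.Ico (0 : ℝ) M ∧
    (blockEntry X).2 ∈ levelIdeal ℚ (Ideal.span {(M : 𝓞 ℚ)})}

/-- The strip `𝓢_M = {X ∈ 𝔫 | (X₀₁)_f ∈ M Ẑ}`, an open-closed additive subgroup containing the box. [folklore] -/
def strip (M : ℕ) : AddSubgroup (blockNilpotent 2 1 (AdeleRing (𝓞 ℚ) ℚ)) :=
  (levelIdeal ℚ (Ideal.span {(M : 𝓞 ℚ)})).comap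
    ((AddMonoidHom.snd (InfiniteAdeleRing ℚ) (FiniteAdeleRing (𝓞 ℚ) ℚ)).comp blockEntry)

/-- Membership in the strip. [folklore] -/
theorem mem_strip_iff {M : ℕ} {X : blockNilpotent 2 1 (AdeleRing (𝓞 ℚ) ℚ)} :
    X ∈ strip M ↔ (blockEntry X).2 ∈ levelIdeal ℚ (Ideal.span {(M : 𝓞 ℚ)}) :=
  Iff.rfl

/-- The real coordinate `X ↦ (X₀₁)_∞ ∈ ℝ` on `𝔫`, a continuous additive map. [folklore] -/
def realCoord : blockNilpotent 2 1 (AdeleRing (𝓞 ℚ) ℚ) →+ ℝ :=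
  (Rat.infiniteAdeleRingEquivReal.toAddMonoidHom.comp
    (AddMonoidHom.fst (InfiniteAdeleRing ℚ) (FiniteAdeleRing (𝓞 ℚ) ℚ))).comp blockEntry

/-- `realCoord X = (X₀₁)_∞` (definitional). [folklore] -/
theorem realCoord_apply (X : blockNilpotent 2 1 (AdeleRing (𝓞 ℚ) ℚ)) :
    realCoord X = Rat.infiniteAdeleRingEquivReal (blockEntry X).1 :=
  rfl

/-- `realCoord` is continuous. [folklore] -/
theorem continuous_realCoord : Continuous realCoord :=
  Rat.continuous_infiniteAdeleRingEquivReal.comp (continuous_fst.comp continuous_blockEntry)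

/-- The finite coordinate `X ↦ (X₀₁)_f` is continuous. [folklore] -/
theorem continuous_snd_blockEntry :
    Continuous fun X : blockNilpotent 2 1 (AdeleRing (𝓞 ℚ) ℚ) => (blockEntry X).2 :=
  continuous_snd.comp continuous_blockEntry

/-- The box is the part of the strip with real coordinate in `[0, M)`. [folklore] -/
theorem box_eq (M : ℕ) : box M = realCoord ⁻¹' Set.Ico (0 : ℝ) M ∩ (strip M : Set _) := by
  ext X
  rfl

/-- The strip is closed (`M Ẑ` is an open, hence closed, subgroup of `𝔸_ℚ^∞`). [folklore] -/
theorem isClosed_strip (M : ℕ) : IsClosed (strip M : Set (blockNilpotent 2 1 (AdeleRing (𝓞 ℚ) ℚ))) :=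
  ((levelIdeal ℚ (Ideal.span {(M : 𝓞 ℚ)})).isClosed_of_isOpen (isOpen_levelIdeal _)).preimage
    continuous_snd_blockEntry

/-- The strip is measurable. [folklore] -/
theorem measurableSet_strip (M : ℕ) : MeasurableSet (strip M : Set (blockNilpotent 2 1 (AdeleRing (𝓞 ℚ) ℚ))) :=
  (isClosed_strip M).measurableSet

/-- The box is measurable. [folklore] -/
theorem measurableSet_box (M : ℕ) : MeasurableSet (box M) := by
  rw [box_eq]
  exact (continuous_realCoord.measurable measurableSet_Ico).inter (measurableSet_strip M)

/-- **The box is a fundamental domain for `𝔫(ℚ)` acting on `𝔫(𝔸_ℚ)`** with respect to every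
measure (Mathlib `IsAddFundamentalDomain.mk'`: measurable, and every orbit meets it exactly once,
`Rat.existsUnique_add_algebraMap_mem_box` transported along `X ↦ X₀₁`). [folklore] -/
theorem isAddFundamentalDomain_box {M : ℕ} (hM : 0 < M) (ν : Measure (blockNilpotent 2 1 (AdeleRing (𝓞 ℚ) ℚ))) :
    IsAddFundamentalDomain (rationalBlock 2 1 ℚ) (box M) ν := by
  refine IsAddFundamentalDomain.mk' (measurableSet_box M).nullMeasurableSet fun X => ?_
  obtain ⟨r, hr, huniq⟩ := Rat.existsUnique_add_algebraMap_mem_box hM (blockEntry X)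
  -- the rational block element with coordinate `r`
  let q : rationalBlock 2 1 ℚ :=
    ⟨blockOfEntry (algebraMap ℚ (AdeleRing (𝓞 ℚ) ℚ) r), blockOfEntry_algebraMap_mem_rationalBlock r⟩
  have hvadd : ∀ (p : rationalBlock 2 1 ℚ), blockEntry (p +ᵥ X) =
      blockEntry X + blockEntry (p : blockNilpotent 2 1 (AdeleRing (𝓞 ℚ) ℚ)) := fun p => by
    rw [AddSubgroup.vadd_def, vadd_eq_add, map_add, add_comm]
  refine ⟨q, ?_, fun p hp => ?_⟩
  · change Rat.infiniteAdeleRingEquivReal (blockEntry (q +ᵥ X)).1 ∈ Set.Ico (0 : ℝ) M ∧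
      (blockEntry (q +ᵥ X)).2 ∈ levelIdeal ℚ (Ideal.span {(M : 𝓞 ℚ)})
    rw [hvadd]
    exact hr
  · obtain ⟨r', hr'⟩ := mem_rationalBlock_iff_blockEntry.1 p.2
    have hp' : Rat.infiniteAdeleRingEquivReal (blockEntry X + algebraMap ℚ (AdeleRing (𝓞 ℚ) ℚ) r').1 ∈
        Set.Ico (0 : ℝ) M ∧
        (blockEntry X + algebraMap ℚ (AdeleRing (𝓞 ℚ) ℚ) r').2 ∈ levelIdeal ℚ (Ideal.span {(M : 𝓞 ℚ)}) := by
      rw [hr', ← hvadd]; exact hp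
    have hrr : r' = r := huniq r' hp'
    apply Subtype.ext
    change (p : blockNilpotent 2 1 (AdeleRing (𝓞 ℚ) ℚ)) = blockOfEntry (algebraMap ℚ (AdeleRing (𝓞 ℚ) ℚ) r)
    rw [← blockOfEntry_blockEntry (p : blockNilpotent 2 1 (AdeleRing (𝓞 ℚ) ℚ)), ← hr', hrr]

/-- `M Ẑ` is compact (a closed subset of the compact `𝒪̂ = ∏_p ℤ_p`). [folklore] -/
theorem Rat.isCompact_levelIdeal (M : ℕ) :
    IsCompact (levelIdeal ℚ (Ideal.span {(M : 𝓞 ℚ)}) : Set (FiniteAdeleRing (𝓞 ℚ) ℚ)) := by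
  haveI : ∀ v : HeightOneSpectrum (𝓞 ℚ), CompactSpace (v.adicCompletionIntegers ℚ) := fun v =>
    compactSpace_adicCompletionIntegers' ℚ v
  refine (FiniteAdeleRing.isCompact_setOf_forall_mem (𝓞 ℚ) ℚ).of_isClosed_subset
    ((levelIdeal ℚ (Ideal.span {(M : 𝓞 ℚ)})).isClosed_of_isOpen (isOpen_levelIdeal _)) fun x hx => ?_
  exact (mem_integralFiniteAdeles_iff.1
    (mem_integralFiniteAdeles_of_mem_levelIdeal (𝔫 := Ideal.span {(M : 𝓞 ℚ)}) hx))

/-- The parametrisation `ℝ × 𝔸_ℚ^∞ → 𝔫`, `(u, a) ↦ (u, a) E₀₁`, a continuous map (indeed a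
homeomorphism) used to exhibit compact subsets of `𝔫`. [folklore] -/
def blockOfRealFinite (p : ℝ × FiniteAdeleRing (𝓞 ℚ) ℚ) : blockNilpotent 2 1 (AdeleRing (𝓞 ℚ) ℚ) :=
  blockOfEntry (Rat.infiniteAdeleRingEquivReal.symm p.1, p.2)

/-- `blockOfRealFinite` is continuous. [folklore] -/
theorem continuous_blockOfRealFinite : Continuous blockOfRealFinite :=
  continuous_blockOfEntry.comp
    ((Rat.continuous_infiniteAdeleRingEquivReal_symm.comp continuous_fst).prodMk continuous_snd)

/-- Every `X ∈ 𝔫` is `blockOfRealFinite` of its coordinates. [folklore] -/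
theorem blockOfRealFinite_coords (X : blockNilpotent 2 1 (AdeleRing (𝓞 ℚ) ℚ)) :
    blockOfRealFinite (realCoord X, (blockEntry X).2) = X := by
  rw [blockOfRealFinite, realCoord_apply, RingEquiv.symm_apply_apply]
  exact blockOfEntry_blockEntry X

/-- The part of the strip over a set `T ⊆ ℝ` is the image of `T × M Ẑ`. [folklore] -/
theorem preimage_realCoord_inter_strip_eq (M : ℕ) (T : Set ℝ) :
    realCoord ⁻¹' T ∩ (strip M : Set _) =
      blockOfRealFinite '' (T ×ˢ (levelIdeal ℚ (Ideal.span {(M : 𝓞 ℚ)}) : Set (FiniteAdeleRing (𝓞 ℚ) ℚ))) := by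
  ext X
  constructor
  · rintro ⟨h1, h2⟩
    exact ⟨(realCoord X, (blockEntry X).2), ⟨h1, h2⟩, blockOfRealFinite_coords X⟩
  · rintro ⟨p, ⟨hp1, hp2⟩, rfl⟩
    refine ⟨?_, ?_⟩
    · change Rat.infiniteAdeleRingEquivReal (blockEntry (blockOfEntry _)).1 ∈ T
      rw [blockEntry_blockOfEntry]
      change Rat.infiniteAdeleRingEquivReal (Rat.infiniteAdeleRingEquivReal.symm p.1) ∈ T
      rw [RingEquiv.apply_symm_apply]; exact hp1
    · change (blockEntry (blockOfEntry _)).2 ∈ levelIdeal ℚ (Ideal.span {(M : 𝓞 ℚ)})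
      rw [blockEntry_blockOfEntry]; exact hp2

/-- The part of the strip over a compact `T ⊆ ℝ` is compact. [folklore] -/
theorem isCompact_preimage_realCoord_inter_strip (M : ℕ) {T : Set ℝ} (hT : IsCompact T) :
    IsCompact (realCoord ⁻¹' T ∩ (strip M : Set (blockNilpotent 2 1 (AdeleRing (𝓞 ℚ) ℚ)))) := by
  rw [preimage_realCoord_inter_strip_eq]
  exact (hT.prod (Rat.isCompact_levelIdeal M)).image continuous_blockOfRealFinite

/-- **The box has finite measure** for every measure finite on compacts (it lies in the compact
image of `[0, M] × M Ẑ`); hence `ℚ \ 𝔸_ℚ` has finite volume. [folklore] -/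
theorem measure_box_lt_top (M : ℕ) (ν : Measure (blockNilpotent 2 1 (AdeleRing (𝓞 ℚ) ℚ)))
    [IsFiniteMeasureOnCompacts ν] : ν (box M) < ⊤ := by
  refine lt_of_le_of_lt (measure_mono ?_)
    ((isCompact_preimage_realCoord_inter_strip M (isCompact_Icc (a := (0 : ℝ)) (b := (M : ℝ)))).measure_lt_top)
  rw [box_eq]
  exact Set.inter_subset_inter_left _ (Set.preimage_mono Set.Ico_subset_Icc_self)

end FundamentalDomain


/-! ### The real marginal of a Haar measure on `𝔫 ≅ 𝔸_ℚ` over the strip is a Lebesgue measure -/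

section Pushforward

variable (M : ℕ) (ν : Measure (blockNilpotent 2 1 (AdeleRing (𝓞 ℚ) ℚ)))

/-- `realCoord` is measurable. [folklore] -/
theorem measurable_realCoord : Measurable realCoord :=
  continuous_realCoord.measurable

/-- The **real marginal** of `ν` over the strip: the image under `X ↦ (X₀₁)_∞` of the restriction
of `ν` to `𝓢_M = {(X₀₁)_f ∈ M Ẑ}`. [folklore] -/
def realMarginal : Measure ℝ :=
  Measure.map realCoord (ν.restrict (strip M : Set (blockNilpotent 2 1 (AdeleRing (𝓞 ℚ) ℚ))))

/-- The element `(u, 0) E₀₁` of the strip with real coordinate `u`. [folklore] -/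
theorem blockOfRealFinite_zero_mem_strip (u : ℝ) : blockOfRealFinite (u, 0) ∈ strip M := by
  rw [mem_strip_iff, blockOfRealFinite, blockEntry_blockOfEntry]
  exact zero_mem _

/-- `realCoord ((u, 0) E₀₁) = u`. [folklore] -/
@[simp]
theorem realCoord_blockOfRealFinite (p : ℝ × FiniteAdeleRing (𝓞 ℚ) ℚ) : realCoord (blockOfRealFinite p) = p.1 := by
  rw [realCoord_apply, blockOfRealFinite, blockEntry_blockOfEntry]
  exact RingEquiv.apply_symm_apply _ _

variable [ν.IsAddHaarMeasure]

/-- Translation by an element of the strip preserves `ν` restricted to the strip. [folklore] -/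
theorem map_add_left_restrict_strip {Y : blockNilpotent 2 1 (AdeleRing (𝓞 ℚ) ℚ)} (hY : Y ∈ strip M) :
    Measure.map (Y + ·) (ν.restrict (strip M : Set _)) = ν.restrict (strip M : Set _) := by
  refine Measure.ext fun T hT => ?_
  have hmeas : Measurable fun X : blockNilpotent 2 1 (AdeleRing (𝓞 ℚ) ℚ) => Y + X := measurable_const_add Y
  rw [Measure.map_apply hmeas hT, Measure.restrict_apply (hmeas hT), Measure.restrict_apply hT]
  have hS : (fun X => Y + X) ⁻¹' T ∩ (strip M : Set _) = (fun X => Y + X) ⁻¹' (T ∩ (strip M : Set _)) := by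
    ext X
    simp only [Set.mem_inter_iff, Set.mem_preimage, SetLike.mem_coe]
    exact and_congr_right fun _ => ⟨fun h => add_mem hY h, fun h => by simpa using sub_mem h hY⟩
  rw [hS, ← Measure.map_apply hmeas (hT.inter (measurableSet_strip M)), map_add_left_eq_self]

/-- **The real marginal is translation invariant.** [folklore] -/
theorem isAddLeftInvariant_realMarginal : (realMarginal M ν).IsAddLeftInvariant := by
  refine ⟨fun u => ?_⟩
  rw [realMarginal, Measure.map_map (measurable_const_add u) (measurable_realCoord)]
  have hcomp : ((fun x : ℝ => u + x) ∘ realCoord) =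
      realCoord ∘ fun X : blockNilpotent 2 1 (AdeleRing (𝓞 ℚ) ℚ) => blockOfRealFinite (u, 0) + X := by
    funext X
    simp only [Function.comp_apply, map_add, realCoord_blockOfRealFinite]
  rw [hcomp, ← Measure.map_map measurable_realCoord (measurable_const_add _),
    map_add_left_restrict_strip M ν (blockOfRealFinite_zero_mem_strip M u)]

/-- **The real marginal is finite on compact sets** (the part of the strip over a compact set is
compact). [folklore] -/
theorem isFiniteMeasureOnCompacts_realMarginal : IsFiniteMeasureOnCompacts (realMarginal M ν) := by
  refine ⟨fun K hK => ?_⟩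
  rw [realMarginal, Measure.map_apply measurable_realCoord hK.measurableSet,
    Measure.restrict_apply (measurable_realCoord hK.measurableSet)]
  exact (isCompact_preimage_realCoord_inter_strip M hK).measure_lt_top

/-- **The real marginal is a multiple of Lebesgue measure** (uniqueness of Haar measure on `ℝ`,
Mathlib `Measure.isAddLeftInvariant_eq_smul`). [folklore] -/
theorem exists_realMarginal_eq_smul_volume : ∃ c : ℝ≥0, realMarginal M ν = c • (volume : Measure ℝ) := by
  haveI := isAddLeftInvariant_realMarginal M ν
  haveI := isFiniteMeasureOnCompacts_realMarginal M ν
  exact ⟨(realMarginal M ν).addHaarScalarFactor volume, Measure.isAddLeftInvariant_eq_smul _ _⟩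

/-- **Integration over the box against a function of the real coordinate**: for continuous
`H : ℝ → ℂ`, `∫_{𝓑_M} H((X₀₁)_∞) dν(X) = c · ∫₀ᴹ H(u) du` with the constant `c = c(M, ν)` of
`exists_realMarginal_eq_smul_volume` (disintegration along `𝔫 ⊇ 𝓢_M → ℝ`). [folklore] -/
theorem exists_setIntegral_box_comp_realCoord :
    ∃ c : ℝ≥0, ∀ (H : ℝ → ℂ), Continuous H →
      ∫ X in box M, H (realCoord X) ∂ν = (c : ℝ) • ∫ u in (0 : ℝ)..M, H u := by
  obtain ⟨c, hc⟩ := exists_realMarginal_eq_smul_volume M ν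
  refine ⟨c, fun H hH => ?_⟩
  have hmeas : MeasurableSet (realCoord ⁻¹' Set.Ico (0 : ℝ) M) := measurable_realCoord measurableSet_Ico
  rw [box_eq, ← Measure.restrict_restrict hmeas,
    ← setIntegral_map measurableSet_Ico hH.aestronglyMeasurable measurable_realCoord.aemeasurable]
  change ∫ u in Set.Ico (0 : ℝ) M, H u ∂(realMarginal M ν) = _
  rw [hc, Measure.restrict_smul, integral_smul_nnreal_measure, intervalIntegral.integral_of_le (by positivity),
    integral_Ico_eq_integral_Ioc, NNReal.smul_def]

end Pushforward

/-! ### Cuspidality of the adelic lift -/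

section Cuspidal

variable {N : ℕ} [NeZero N] {k : ℤ} {F : Type*} [FunLike F ℍ ℂ]
  [CuspFormClass F (CongruenceSubgroup.Gamma1 N) k] (f : F)

/-- **Cuspidality of the adelic lift `φ_f`** (Gelbart (1975), Prop. 3.1 (vii); Bump (1997), §3.6,
`φ ∈ A₀`): the constant term of `adelicLift N k f` along the unipotent radical of the Borel
vanishes, in the sense of the trunk's `ConstantTermVanishes 2 ℚ · 1` — for every Haar measure
`ν` on `𝔫(𝔸_ℚ)`, every fundamental domain `𝓕` for `𝔫(ℚ)` and every `x ∈ GL₂(𝔸_ℚ)`, the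
function `X ↦ φ_f([x (1 + X)])` is integrable on `𝓕` with integral `0`. Proof: the integrand is
`Θ(X) = φ_f(n(-X₀₁) x⁻¹)`, `𝔫(ℚ)`-periodic, continuous and bounded; write `x⁻¹ = γ h` with
`h ∈ GL₂(ℝ)⁺ × K₁(N)` and choose `M` with `γ⁻¹ n(M Ẑ) γ ⊆ K₁(N)`, `γ⁻¹ n(M) γ ∈ Γ₁(N)`
(`Rat.exists_level_conj_upperRightHom`); transfer the integral to the box `𝓑_M` (a fundamental
domain of finite measure, `isAddFundamentalDomain_box`), on which
`Θ(X) = archLift k f (γ⁻¹ n(-(X₀₁)_∞) x⁻¹_∞)` depends only on the real coordinate; the real marginal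
of `ν` over the strip is a multiple of Lebesgue measure (`exists_setIntegral_box_comp_realCoord`),
and `∫₀ᴹ archLift k f (γ⁻¹ n(t) x⁻¹_∞) dt = 0` because it is a non-zero multiple (possibly complex
conjugated, if `det x_∞ < 0`) of the zeroth Fourier coefficient of the cusp form `f ∣[k] γ⁻¹` on a
horizontal line (`intervalIntegral_archLift_horocycle_eq_zero`). This discharges the named fact
`adelicLift_constantTermVanishes` of `NewformAdelisationLift`. [cite: Gelbart1975, Prop. 3.1] -/
theorem constantTermVanishes_adelicLift : ConstantTermVanishes 2 ℚ (adelicLift N k f) 1 := by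
  intro ν _ 𝓕 h𝓕 x
  -- notation
  set g : GL (Fin 2) (AdeleRing (𝓞 ℚ) ℚ) := (x : GL (Fin 2) (AdeleRing (𝓞 ℚ) ℚ))⁻¹ with hg
  obtain ⟨γ, hγ⟩ := Rat.exists_ofGlobal_inv_mul_mem_plusLevelOne (Ideal.span {(N : 𝓞 ℚ)}) g
  obtain ⟨M, hM, hfinM, harchM⟩ := Rat.exists_level_conj_upperRightHom N γ
  have hMr : (0 : ℝ) < M := by exact_mod_cast hM
  set A : GL (Fin 2) ℝ := (Matrix.GeneralLinearGroup.map (Rat.castHom ℝ) γ)⁻¹ with hA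
  set B : GL (Fin 2) ℝ := Rat.archGL 2 g with hB
  set H : ℝ → ℂ := fun u => archLift k f (A * ((upperRightHom u : GL (Fin 2) ℝ) * B)) with hH
  set Θ : blockNilpotent 2 1 (AdeleRing (𝓞 ℚ) ℚ) → ℂ := fun X =>
    adelicLift N k f ((AdelicGroupData.gl 2 ℚ).toAutomorphicQuotient
      (x * glUnipotent 2 1 ℚ (Multiplicative.ofAdd X))) with hΘ
  have hAM : A * upperRightHom (M : ℝ) * A⁻¹ ∈
      ((CongruenceSubgroup.Gamma1 N : Subgroup SL(2, ℤ)) : Subgroup (GL (Fin 2) ℝ)) := by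
    rw [hA, inv_inv]; exact harchM
  -- (1) the integrand on the group
  have hΘ1 : ∀ X, Θ X = adelicLiftFun N k f (upperRightHom (-(blockEntry X)) * g) := fun X => by
    simp only [hΘ, adelicLift_toAutomorphicQuotient]
    congr 1
    rw [hg, AddChar.map_neg_eq_inv, ← unipotentOfBlock_eq_upperRightHom, ← _root_.mul_inv_rev]
    rfl
  -- (2) on the strip the integrand is `H(-(X₀₁)_∞)`
  have hΘ2 : ∀ X ∈ strip M, Θ X = H (-(realCoord X)) := fun X hX => by
    rw [hΘ1]
    set t : AdeleRing (𝓞 ℚ) ℚ := -(blockEntry X) with ht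
    have ht2 : t.2 ∈ levelIdeal ℚ (Ideal.span {(M : 𝓞 ℚ)}) := by
      rw [ht]; exact neg_mem (mem_strip_iff.1 hX)
    have hw : (GLn.ofGlobal 2 ℚ γ)⁻¹ * upperRightHom t * GLn.ofGlobal 2 ℚ γ ∈
        Rat.plusLevelOne (Ideal.span {(N : 𝓞 ℚ)}) := by
      rw [Rat.mem_plusLevelOne_iff]
      constructor
      · have hdet1 : Matrix.GeneralLinearGroup.det
            (Rat.archGL 2 ((GLn.ofGlobal 2 ℚ γ)⁻¹ * upperRightHom t * GLn.ofGlobal 2 ℚ γ)) = 1 := by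
          rw [show Rat.archGL 2 ((GLn.ofGlobal 2 ℚ γ)⁻¹ * upperRightHom t * GLn.ofGlobal 2 ℚ γ) =
              (Rat.archGL 2 (GLn.ofGlobal 2 ℚ γ))⁻¹ * Rat.archGL 2 (upperRightHom t) * Rat.archGL 2 (GLn.ofGlobal 2 ℚ γ) by
                rw [map_mul, map_mul, map_inv],
            det_inv_mul_mul, Rat.archGL_upperRightHom, det_upperRightHom]
        rw [hdet1, Units.val_one]
        exact one_pos
      · rw [map_mul, map_mul, map_inv, Rat.sndHom_ofGlobal, Rat.sndHom_upperRightHom]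
        exact hfinM _ ht2
    have hmem : (GLn.ofGlobal 2 ℚ γ)⁻¹ * (upperRightHom t * g) ∈ Rat.plusLevelOne (Ideal.span {(N : 𝓞 ℚ)}) := by
      have : (GLn.ofGlobal 2 ℚ γ)⁻¹ * (upperRightHom t * g) =
          ((GLn.ofGlobal 2 ℚ γ)⁻¹ * upperRightHom t * GLn.ofGlobal 2 ℚ γ) * ((GLn.ofGlobal 2 ℚ γ)⁻¹ * g) := by
        group
      rw [this]; exact mul_mem hw hγ
    rw [adelicLiftFun_eq_archLift f hmem, map_mul, map_mul, map_inv, Rat.archGL_ofGlobal, Rat.archGL_upperRightHom]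
    change _ = archLift k f (A * ((upperRightHom (-realCoord X) : GL (Fin 2) ℝ) * B))
    rw [hA, hB, ht, AdeleRing.fst_neg', map_neg, realCoord_apply]
  -- (3) periodicity, continuity, boundedness
  have hper : ∀ (q : rationalBlock 2 1 ℚ) X, Θ (q +ᵥ X) = Θ X := fun q X => by
    simp only [hΘ]
    exact toAutomorphicQuotient_mul_glUnipotent_vadd (adelicLift N k f) x q X
  have hcont : Continuous Θ := by
    have h1 : Continuous fun X : blockNilpotent 2 1 (AdeleRing (𝓞 ℚ) ℚ) =>
        x * glUnipotent 2 1 ℚ (Multiplicative.ofAdd X) :=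
      continuous_const.mul continuous_unipotentOfBlock_ofAdd
    exact (continuous_adelicLift f (ModularFormClass.continuous (Γ := CongruenceSubgroup.Gamma1 N) (k := k) f)).comp
      ((AdelicGroupData.gl 2 ℚ).continuous_toAutomorphicQuotient.comp h1)
  obtain ⟨C, hC⟩ := exists_bound_adelicLift (N := N) (k := k) f
  have hbd : ∀ X, ‖Θ X‖ ≤ C := fun X => hC _
  -- (4) the box
  have hbox := isAddFundamentalDomain_box hM ν
  have hboxfin := measure_box_lt_top M ν
  have hint_box : IntegrableOn Θ (box M) ν :=
    Measure.integrableOn_of_bounded hboxfin.ne hcont.aestronglyMeasurable (Filter.Eventually.of_forall hbd)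
  refine ⟨(hbox.integrableOn_iff h𝓕 hper).1 hint_box, ?_⟩
  rw [h𝓕.setIntegral_eq hbox hper, setIntegral_congr_fun (measurableSet_box M)
    (fun X hX => hΘ2 X ((box_eq M).le hX).2)]
  -- (5) continuity of `H` (it is `Θ` along a continuous section of the real coordinate)
  have hHcont : Continuous H := by
    have : H = fun u => Θ (blockOfRealFinite (-u, 0)) := by
      funext u
      rw [hΘ2 _ (blockOfRealFinite_zero_mem_strip M (-u)), realCoord_blockOfRealFinite, neg_neg]
    rw [this]
    exact hcont.comp (continuous_blockOfRealFinite.comp (continuous_neg.prodMk continuous_const))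
  -- (6) disintegrate along the real coordinate
  obtain ⟨c, hc⟩ := exists_setIntegral_box_comp_realCoord M ν
  rw [hc (fun u => H (-u)) (hHcont.comp continuous_neg)]
  refine smul_eq_zero_of_right _ ?_
  -- (7) the real integral over a period vanishes
  have hHper : Function.Periodic H M := archLift_horocycle_periodic k f A B hAM
  rw [intervalIntegral.integral_comp_neg, neg_zero]
  have hshift := hHper.intervalIntegral_add_eq (-M) 0
  rw [neg_add_cancel, zero_add] at hshift
  rw [hshift]
  -- (8) sign of `det B`
  rcases lt_or_gt_of_ne (B.det.ne_zero) with hneg | hpos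
  · -- `det B < 0`: conjugate to `GL₂(ℝ)⁺`
    set ε : GL (Fin 2) ℝ := Matrix.GeneralLinearGroup.map (Rat.castHom ℝ) Rat.signGL with hε
    have hεε : ε * ε = 1 := by
      rw [hε, ← map_mul, Rat.signGL, ← map_mul]
      have : (![(-1 : ℚˣ), 1] * ![(-1 : ℚˣ), 1]) = 1 := by
        ext i; fin_cases i <;> simp
      rw [this, map_one, map_one]
    have hdetε : ε.det.val = -1 := by rw [hε, ← Rat.archGL_ofGlobal, Rat.det_archGL_signGL]
    have hB' : 0 < (B * ε).det.val := by
      rw [map_mul, Units.val_mul, hdetε, mul_neg_one]; exact neg_pos.2 hneg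
    have hHconj : ∀ u, H u = (starRingEnd ℂ) (archLift k f (A * ((upperRightHom u : GL (Fin 2) ℝ) * (B * ε)))) := by
      intro u
      have e1 : A * ((upperRightHom u : GL (Fin 2) ℝ) * B) = A * ((upperRightHom u : GL (Fin 2) ℝ) * (B * ε)) * ε := by
        rw [mul_assoc, mul_assoc, mul_assoc, hεε, mul_one]
      simp only [hH]
      rw [e1, archLift_mul_signGL]
    rw [intervalIntegral.integral_congr (g := fun u => (starRingEnd ℂ)
        (archLift k f (A * ((upperRightHom u : GL (Fin 2) ℝ) * (B * ε))))) (fun u _ => hHconj u),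
      intervalIntegral.integral_of_le hMr.le, integral_conj, ← intervalIntegral.integral_of_le hMr.le,
      intervalIntegral_archLift_horocycle_eq_zero f A hB' hMr hAM, map_zero]
  · exact intervalIntegral_archLift_horocycle_eq_zero f A hpos hMr hAM

/-- **Discharge of the named fact `adelicLift_constantTermVanishes`** of `NewformAdelisationLift`
(Gelbart (1975), Prop. 3.1 (vii)). [cite: Gelbart1975, Prop. 3.1] -/
theorem adelicLift_constantTermVanishes_holds : adelicLift_constantTermVanishes :=
  fun _ _ _ f => constantTermVanishes_adelicLift f

end Cuspidal

end Literature.NumberTheory.Automorphic
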